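import Mathlib
import HarnessLib
import Literature.NumberTheory.DiophantineGeometry.RothPrelim
import Literature.NumberTheory.DiophantineGeometry.RothTaylor
import Literature.NumberTheory.DiophantineGeometry.RothWronskian
import Literature.NumberTheory.DiophantineGeometry.RothLemmaTransport

/-!
# Roth's theorem after Schmidt (LNM 785, Ch. V) — Roth's Lemma: the minimal decomposition and
the Wronskian `W = V·U`

Source: W. M. Schmidt, *Diophantine Approximation*, LNM 785 (1980), Ch. V §10, proof of
Theorem 10A, inductive step (pp. 130–131) [Schmidt1980].

From a non-zero `P(X₁, …, X_m)` (here: `m + 1` variables `X₀, …, X_m`, the last one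
distinguished) Schmidt chooses a decomposition `P = Σ_{j=1}^k φ_j(X₁,…,X_{m-1}) ψ_j(X_m)` with
`k ≤ r_m + 1` minimal, so that the `φ_j` and the `ψ_j` are linearly independent (10.8); Lemma 9A
gives operators `Δ'_i` in `X₁, …, X_{m-1}` of orders `≤ i - 1 ≤ k - 1` (10.9) with
`V = det (Δ'_i φ_j) ≠ 0`, and `U = det ((1/(i-1)!) ∂^{i-1} ψ_j) ≠ 0`; then
`W = det ((1/(j-1)!) ∂_{X_m}^{j-1} Δ'_i P) = V · U ≠ 0`, with integer coefficients.

`Roth.exists_wronskian_package` produces exactly this, over `ℝ`: instead of minimality of `k` we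
take for the `φ_j` a basis of the span of the coefficients of the powers of `X_m` (so
`k = dim ≤ deg_{X_m} P + 1`) and for the `ψ_j` the corresponding coordinate polynomials (linearly
independent by duality); Lemma 9A (`Roth.exists_generalizedWronskian_ne_zero`) is applied to both
families (for one variable it gives orders `ν_j ≤ j - 1`), and the identity `W = V·U` is the
product of the two matrices via the splitting of derivatives in separated variables
(`Roth.hasseD_sep_mul`). The Wronskian `W` itself is the integer polynomial
`det ((P_{(μ_i, ν_j)})_{i,j})` (`Roth.snocF`), and the identity is stated after base change to `ℝ`.

## References

* [Schmidt1980] W. M. Schmidt, *Diophantine Approximation*, LNM 785, Springer 1980, Ch. V,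
  proof of Theorem 10A, (10.8), (10.9), pp. 130–131.
-/

noncomputable section

open MvPolynomial Finset

namespace Literature.NumberTheory.DiophantineGeometry

namespace Roth

variable {m : ℕ}

/-! ### Linear independence of coordinate polynomials -/

/-- The coordinate polynomials `ψ_t = Σ_l A_{t l} X₀^l` of a spanning family are linearly
independent: if `b` is a basis of a space `E` and the vectors `c_l ∈ E` span `E`, then the
functions `t ↦ (coordinate t of c_l)_l` are linearly independent. Here in the concrete form needed:
for `Σ_t γ_t A_{t l} = 0` for all `l` we get `γ = 0`. [folklore] -/
theorem eq_zero_of_forall_sum_mul_repr_eq_zero {E : Type*} [AddCommGroup E] [Module ℝ E]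
    {k : ℕ} (b : Module.Basis (Fin k) ℝ E) {ι : Type*} (c : ι → E)
    (hspan : Submodule.span ℝ (Set.range c) = ⊤) (γ : Fin k → ℝ)
    (h : ∀ l, ∑ t, γ t * b.repr (c l) t = 0) : γ = 0 := by
  set F : E →ₗ[ℝ] ℝ := ∑ t, γ t • b.coord t with hF
  have hFc : ∀ l, F (c l) = 0 := by
    intro l
    rw [hF, LinearMap.sum_apply]
    simp only [LinearMap.smul_apply, Module.Basis.coord_apply, smul_eq_mul]
    exact h l
  have hF0 : F = 0 := by
    apply LinearMap.ext_on_range hspan   -- `Submodule.span ℝ (range c) = ⊤`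
    intro l
    rw [hFc, LinearMap.zero_apply]
  funext t
  have := LinearMap.congr_fun hF0 (b t)
  rw [hF, LinearMap.sum_apply, LinearMap.zero_apply] at this
  simp only [LinearMap.smul_apply, Module.Basis.coord_apply, Module.Basis.repr_self, smul_eq_mul] at this
  rw [Finset.sum_eq_single t] at this
  · simpa using this
  · intro t' _ ht'
    rw [Finsupp.single_eq_of_ne ht', mul_zero]
  · intro ht; exact absurd (mem_univ t) ht

/-! ### The Wronskian package -/

/-- **The decomposition (10.8), Lemma 9A twice, and `W = V · U`** (Schmidt, proof of Theorem 10A,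
inductive step): for a non-zero integer polynomial `P` in `X₀, …, X_m` of degree `≤ L` in `X_m`
there are `1 ≤ k ≤ L + 1`, multi-indices `μ₀, …, μ_{k-1}` in the first `m` variables with
`|μ_s| ≤ s` and orders `ν_j ≤ j` in the last variable, a non-zero `V ∈ ℝ[X₀,…,X_{m-1}]` and a
non-zero `U ∈ ℝ[X_m]`, such that the integer Wronskian `W = det (P_{(μ_s, ν_j)})_{s,j<k}`
satisfies `W = V · U` (identity in `ℝ[X₀, …, X_m]`). [cite: Schmidt1980, Ch. V Thm 10A (inductive step, (10.8)–(10.9))] -/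
theorem exists_wronskian_package (P : MvPolynomial (Fin (m + 1)) ℤ) (hP : P ≠ 0) (L : ℕ)
    (hL : degreeOf (Fin.last m) P ≤ L) :
    ∃ k : ℕ, 0 < k ∧ k ≤ L + 1 ∧
    ∃ μ : Fin k → (Fin m →₀ ℕ), (∀ s, ∑ h, μ s h ≤ (s : ℕ)) ∧
    ∃ ν : Fin k → ℕ, (∀ j, ν j ≤ (j : ℕ)) ∧
    ∃ V : MvPolynomial (Fin m) ℝ, V ≠ 0 ∧ ∃ U : MvPolynomial (Fin 1) ℝ, U ≠ 0 ∧
      map (Int.castRingHom ℝ)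
          (Matrix.det (Matrix.of fun s j : Fin k => hasseD (snocF (μ s) (ν j)) P)) =
        rename Fin.castSucc V * rename (fun _ : Fin 1 => Fin.last m) U := by
  classical
  -- the real polynomial and its slices
  set PR : MvPolynomial (Fin (m + 1)) ℝ := map (Int.castRingHom ℝ) P with hPR
  have hPR0 : PR ≠ 0 := by
    rw [hPR]
    intro h0
    apply hP
    apply (MvPolynomial.map_injective (Int.castRingHom ℝ) Int.cast_injective)
    rw [h0, map_zero]
  have hPRdeg : degreeOf (Fin.last m) PR ≤ L := by
    refine le_trans ?_ hL
    rw [hPR, degreeOf_le_iff]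
    intro j hj
    exact monomial_le_degreeOf _ (support_map_subset _ _ hj)
  set Cf : Fin (L + 1) → MvPolynomial (Fin m) ℝ := fun l => sliceLast (l : ℕ) PR with hCf
  have hrecon : PR = ∑ l : Fin (L + 1), rename Fin.castSucc (Cf l) * X (Fin.last m) ^ (l : ℕ) := by
    rw [Fin.sum_univ_eq_sum_range (fun l => rename Fin.castSucc (sliceLast l PR) *
      X (Fin.last m) ^ l) (L + 1)]
    exact eq_sum_sliceLast PR hPRdeg
  -- the span of the slices and a basis of it
  set Esp : Submodule ℝ (MvPolynomial (Fin m) ℝ) := Submodule.span ℝ (Set.range Cf) with hEsp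
  haveI : Module.Finite ℝ Esp := Module.Finite.span_of_finite ℝ (Set.finite_range Cf)
  set k : ℕ := Module.finrank ℝ Esp with hk
  set b : Module.Basis (Fin k) ℝ Esp := Module.finBasis ℝ Esp with hb
  have hkL : k ≤ L + 1 := by
    have := finrank_range_le_card (R := ℝ) Cf
    simpa [Set.finrank] using this
  -- the `φ`'s
  set φ : Fin k → MvPolynomial (Fin m) ℝ := fun t => (b t : MvPolynomial (Fin m) ℝ) with hφ
  have hφli : LinearIndependent ℝ φ := by
    have := b.linearIndependent.map' Esp.subtype (Submodule.ker_subtype Esp)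
    exact this
  -- the coordinates
  have hCfmem : ∀ l, Cf l ∈ Esp := fun l => Submodule.subset_span ⟨l, rfl⟩
  set cE : Fin (L + 1) → Esp := fun l => ⟨Cf l, hCfmem l⟩ with hcE
  have hcEspan : Submodule.span ℝ (Set.range cE) = ⊤ := by
    apply Submodule.map_injective_of_injective Esp.injective_subtype
    rw [Submodule.map_span, Submodule.map_top, Submodule.range_subtype, ← Set.range_comp]
    rfl
  set A : Fin k → Fin (L + 1) → ℝ := fun t l => b.repr (cE l) t with hA
  have hCfsum : ∀ l, Cf l = ∑ t, A t l • φ t := by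
    intro l
    have := congrArg (fun v : Esp => (v : MvPolynomial (Fin m) ℝ)) (b.sum_repr (cE l))
    simp only [Submodule.coe_sum, Submodule.coe_smul] at this
    exact this.symm
  -- the `ψ`'s
  set ψ : Fin k → MvPolynomial (Fin 1) ℝ := fun t =>
    ∑ l : Fin (L + 1), monomial (Finsupp.single 0 (l : ℕ)) (A t l) with hψ
  have hcoeffψ : ∀ t (l : Fin (L + 1)), coeff (Finsupp.single 0 (l : ℕ)) (ψ t) = A t l := by
    intro t l
    rw [hψ]
    dsimp only
    rw [coeff_sum, Finset.sum_eq_single l]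
    · rw [coeff_monomial, if_pos rfl]
    · intro l' _ hl'
      rw [coeff_monomial, if_neg]
      intro h
      apply hl'
      exact Fin.ext (Finsupp.single_injective 0 h)
    · intro h; exact absurd (mem_univ l) h
  have hψli : LinearIndependent ℝ ψ := by
    rw [Fintype.linearIndependent_iff]
    intro γ hγ
    have h1 : ∀ l : Fin (L + 1), ∑ t, γ t * A t l = 0 := by
      intro l
      have := congrArg (coeff (Finsupp.single 0 (l : ℕ))) hγ
      rw [coeff_sum, coeff_zero] at this
      simpa only [coeff_smul, smul_eq_mul, hcoeffψ] using this
    have := eq_zero_of_forall_sum_mul_repr_eq_zero b cE hcEspan γ h1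
    exact fun t => congrFun this t
  -- `P = Σ_t φ̂_t ψ̂_t`
  have hdecomp : PR = ∑ t, rename Fin.castSucc (φ t) *
      rename (fun _ : Fin 1 => Fin.last m) (ψ t) := by
    rw [hrecon]
    have hX : ∀ l : ℕ, (X (Fin.last m) : MvPolynomial (Fin (m + 1)) ℝ) ^ l =
        rename (fun _ : Fin 1 => Fin.last m) (monomial (Finsupp.single 0 l) 1) := by
      intro l
      rw [rename_monomial, mapDomain_const_single, X_pow_eq_monomial]
    simp_rw [hCfsum, map_sum, Finset.sum_mul, hψ, map_sum, Finset.mul_sum]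
    rw [Finset.sum_comm]
    refine Finset.sum_congr rfl fun t _ => Finset.sum_congr rfl fun l _ => ?_
    have hmono : (monomial (Finsupp.single 0 (l : ℕ)) (A t l) : MvPolynomial (Fin 1) ℝ) =
        A t l • monomial (Finsupp.single 0 (l : ℕ)) 1 := by
      rw [smul_monomial, smul_eq_mul, mul_one]
    rw [map_smul, hX, hmono, map_smul, smul_mul_assoc, mul_smul_comm]
  -- `k ≥ 1`
  have hk0 : 0 < k := by
    by_contra hk0
    push Not at hk0
    have hk0' : k = 0 := Nat.le_zero.mp hk0
    apply hPR0
    rw [hdecomp]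
    apply Finset.sum_eq_zero
    intro t _
    exact absurd t.isLt (by omega)
  -- Lemma 9A for the `φ`'s and the `ψ`'s
  obtain ⟨μ, hμ, hV⟩ := exists_generalizedWronskian_ne_zero φ hφli
  obtain ⟨μ', hμ', hU⟩ := exists_generalizedWronskian_ne_zero ψ hψli
  set ν : Fin k → ℕ := fun j => μ' j 0 with hν
  have hμ'eq : ∀ j, μ' j = Finsupp.single 0 (ν j) := fun j => finsupp_fin_one_eq (μ' j)
  refine ⟨k, hk0, hkL, μ, hμ, ν, fun j => by simpa [hν] using hμ' j,
    Matrix.det (Matrix.of fun s t : Fin k => hasseD (μ s) (φ t)), hV,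
    Matrix.det (Matrix.of fun s t : Fin k => hasseD (μ' s) (ψ t)), hU, ?_⟩
  -- the matrix identity
  set f := (Fin.castSucc : Fin m → Fin (m + 1)) with hf
  set g := (fun _ : Fin 1 => Fin.last m) with hg
  have hfi : Function.Injective f := Fin.castSucc_injective m
  have hgi : Function.Injective g := fun a b _ => Subsingleton.elim a b
  have hfg : ∀ a b, f a ≠ g b := fun a _ h => (Fin.castSucc_lt_last a).ne h
  have hentry : ∀ s j : Fin k, hasseD (snocF (μ s) (ν j)) PR =
      ∑ t, rename f (hasseD (μ s) (φ t)) * rename g (hasseD (μ' j) (ψ t)) := by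
    intro s j
    rw [hdecomp, hasseD_sum, snocF_eq_mapDomain_add, ← hμ'eq j]
    exact Finset.sum_congr rfl fun t _ => hasseD_sep_mul hfi hgi hfg (μ s) (μ' j) (φ t) (ψ t)
  have hmat : (Matrix.of fun s j : Fin k => hasseD (snocF (μ s) (ν j)) PR) =
      (Matrix.of fun s t : Fin k => rename f (hasseD (μ s) (φ t))) *
        (Matrix.of fun t j : Fin k => rename g (hasseD (μ' j) (ψ t))) := by
    refine Matrix.ext fun s j => ?_
    rw [Matrix.mul_apply, Matrix.of_apply]
    exact hentry s j
  have hmapdet : map (Int.castRingHom ℝ)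
      (Matrix.det (Matrix.of fun s j : Fin k => hasseD (snocF (μ s) (ν j)) P)) =
      Matrix.det (Matrix.of fun s j : Fin k => hasseD (snocF (μ s) (ν j)) PR) := by
    rw [RingHom.map_det]
    congr 1
    ext s j
    simp [hPR, map_hasseD]
  rw [hmapdet, hmat, Matrix.det_mul, AlgHom.map_det, AlgHom.map_det]
  congr 1
  rw [← Matrix.det_transpose]
  rfl

end Roth

end Literature.NumberTheory.DiophantineGeometry
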